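import Mathlib
import Literature.NumberTheory.LFunctions.Zhang2022.Section17R1PrimeBulkPointwise
import Literature.NumberTheory.LFunctions.Zhang2022.Section3Lemma32FlatLong
import HarnessLib

/-!
# Zhang (2022) §17.u021, remainder `R₁`, piece M2L-p BULK: the `D⁴`-TRUNCATION TAIL summed —
# reduction to `Σ_{D⁴<n≤X} ν(n)²τ₂(n)/n` (where Lemma 3.2♭, long range, acts)

Topic `Literature/NumberTheory/LFunctions/Zhang2022` (Landau–Siegel audit tree; verdict-neutral).
Y. Zhang, *Discrete mean estimates and the Landau–Siegel zero*, arXiv:2211.02515v1 (2022)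
[Zhang2022LandauSiegel] — **an unrefereed manuscript under adjudication**; nothing here asserts or denies
its Theorems 1–2. §17 p. 98 (u021; no bound in print). Lane ZHANG-L, WP16 leaf h17_9, sub-leaf `R₁` of
`Step17_u021Chi`, piece M2L-p BULK (owner's cut 2026-08-27T02:29:31Z; blueprint
`wp16/zl-w16-p3/R1-BULK-PLAN.md`, Step D3). The tail term of `Section17R1PrimeBulkPointwise.
norm_nuOneStar_prime_arg_le`, `T(q₂,p) = Σ_{a′∣q₂, D⁴<pa′} |ν(pa′)|²τ₂(q₂/a′)`, summed against the
outer `R₁` weights with `|ν(l)| ≤ τ₂(l)`: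

  `Σ_{l<D⁴} τ₂(l)/l Σ_{l=q₁q₂} τ₂(q₁) Σ_{p∈P} T(q₂,p)/p ≤ K₄² · (log₂ X) · Σ_{D⁴<n≤X} |ν(n)|²τ₂(n)/n`

for any finite set `P` of primes with `pa′ ≤ X` on the range (`K₄ = Σ_{n<D⁴} τ₂(n)²/n`). THIS FILE
proves the core count `(p, a′) ↦ n = pa′` with multiplicity `#{p ∈ P : p ∣ n} ≤ ω(n) ≤ log₂ n`
(`sum_tau_div_sum_prime_le`: `Σ_{a′<N} τ₂(a′)/a′ Σ_{p∈P, D⁴<pa′} |ν(pa′)|²/p ≤ log₂X·Σ_{D⁴<n≤X}|ν(n)|²τ₂(n)/n`)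
and the box re-indexing tool `sum_Ico_sum_antidiag_le`; the two wrapping re-indexings `(l; q₁,q₂)`,
`(q₂; a′,r)` are the next file (blueprint `wp16/zl-w16-p3/R1-BULK-PLAN.md` Step D3). The right side is
what `Lemma32Flat.lemma_3_2_flat_long` bounds by `C𝓛^{−2007}` under (A) (not applied here).
Theorems only; axioms standard.

## References

* Y. Zhang, arXiv:2211.02515v1 (2022), §17 p. 98 (u021), §3 Lemma 3.2. [cite: Zhang2022LandauSiegel, §17 u021 p.98]
-/

noncomputable section

open Complex Real Finset ArithmeticFunction
open Literature.NumberTheory.LFunctions.Zhang2022.Skeleton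
open Literature.NumberTheory.LFunctions.Zhang2022.Typed.Section17
open Literature.NumberTheory.LFunctions.Zhang2022.MeanSquareMajorant

namespace Literature.NumberTheory.LFunctions.Zhang2022.Phi3Eval

variable {D : ℕ} (χ : DirichletCharacter ℂ D)

/-! ## §1. Re-indexing tools -/

omit χ in
/-- `Σ_{1≤l<N} Σ_{l = ab} G(a,b) ≤ Σ_{1≤a<N} Σ_{1≤b<N} G(a,b)` for `G ≥ 0` (the pairs `(a,b)` with
`ab < N` inject into the box). [cite: Zhang2022LandauSiegel, §17 u021 p.98] -/
theorem sum_Ico_sum_antidiag_le (N : ℕ) (G : ℕ × ℕ → ℝ) (hG : ∀ q, 0 ≤ G q) :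
    ∑ l ∈ Finset.Ico 1 N, ∑ q ∈ l.divisorsAntidiagonal, G q ≤
      ∑ a ∈ Finset.Ico 1 N, ∑ b ∈ Finset.Ico 1 N, G (a, b) := by
  classical
  rw [← Finset.sum_product (s := Finset.Ico 1 N) (t := Finset.Ico 1 N) (f := fun q => G q)]
  have hdisj : ((Finset.Ico 1 N : Finset ℕ) : Set ℕ).PairwiseDisjoint Nat.divisorsAntidiagonal := by
    intro l₁ _ l₂ _ hne
    rw [Function.onFun, Finset.disjoint_left]
    intro q h1 h2
    rw [Nat.mem_divisorsAntidiagonal] at h1 h2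
    exact hne (h1.1.symm.trans h2.1)
  rw [← Finset.sum_biUnion hdisj]
  refine Finset.sum_le_sum_of_subset_of_nonneg ?_ fun q _ _ => hG q
  intro q hq
  rw [Finset.mem_biUnion] at hq
  obtain ⟨l, hl, hq⟩ := hq
  rw [Finset.mem_Ico] at hl
  rw [Nat.mem_divisorsAntidiagonal] at hq
  obtain ⟨h1, h2, h3, h4⟩ := bounds_of_mem_antidiag (Nat.mem_divisorsAntidiagonal.2 hq)
  rw [Finset.mem_product, Finset.mem_Ico, Finset.mem_Ico]
  refine ⟨⟨Nat.one_le_iff_ne_zero.2 h1, lt_of_le_of_lt h3 hl.2⟩,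
    ⟨Nat.one_le_iff_ne_zero.2 h2, lt_of_le_of_lt h4 hl.2⟩⟩

omit χ in
/-- The number of primes (from any finite set of primes) dividing `n ≥ 1` is at most `log₂ n`.
[cite: Zhang2022LandauSiegel, §17 u021 p.98] -/
theorem card_filter_prime_dvd_le_log (P : Finset ℕ) (hP : ∀ p ∈ P, p.Prime) {n : ℕ} (hn : n ≠ 0) :
    ((P.filter (fun p => p ∣ n)).card : ℝ) ≤ Nat.log 2 n := by
  classical
  have hsub : P.filter (fun p => p ∣ n) ⊆ n.primeFactors := by
    intro p hp
    rw [Finset.mem_filter] at hp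
    exact Nat.mem_primeFactors.2 ⟨hP p hp.1, hp.2, hn⟩
  have h1 : (P.filter (fun p => p ∣ n)).card ≤ n.primeFactors.card := Finset.card_le_card hsub
  have h2 : 2 ^ n.primeFactors.card ≤ n := by
    calc 2 ^ n.primeFactors.card ≤ ∏ p ∈ n.primeFactors, p :=
          Finset.pow_card_le_prod _ _ _ fun p hp => (Nat.prime_of_mem_primeFactors hp).two_le
      _ ≤ n := Nat.le_of_dvd (Nat.pos_of_ne_zero hn) (Nat.prod_primeFactors_dvd n)
  have h3 : n.primeFactors.card ≤ Nat.log 2 n := Nat.le_log_of_pow_le (by norm_num) h2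
  exact_mod_cast h1.trans h3

/-! ## §2. The summed tail -/

/-- **The `(p, a′) ↦ n = pa′` count**: for a finite set `P` of primes and `N, X` with `N·max P ≤ X`-type
control given as the hypothesis `hX`,
`Σ_{a′∈[1,N)} τ₂(a′)/a′ · Σ_{p∈P, D⁴<pa′} |ν(pa′)|²/p ≤ (log₂ X)·Σ_{D⁴<n≤X} |ν(n)|²τ₂(n)/n`.
[cite: Zhang2022LandauSiegel, §17 u021 p.98] -/
theorem sum_tau_div_sum_prime_le (P : Finset ℕ) (hP : ∀ p ∈ P, p.Prime) (N X : ℕ)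
    (hX : ∀ p ∈ P, ∀ a ∈ Finset.Ico 1 N, p * a ≤ X) :
    ∑ a ∈ Finset.Ico 1 N, tau 2 a / a *
        ∑ p ∈ P with D ^ 4 < p * a, ‖nu χ (p * a)‖ ^ 2 / p ≤
      (Nat.log 2 X : ℝ) * ∑ n ∈ Finset.Ioc (D ^ 4) X, ‖nu χ n‖ ^ 2 * tau 2 n / n := by
  classical
  -- rewrite as a double sum over (p, a) of τ₂(a)|ν(pa)|²/(pa)
  have hstep1 : ∑ a ∈ Finset.Ico 1 N, tau 2 a / a *
      ∑ p ∈ P with D ^ 4 < p * a, ‖nu χ (p * a)‖ ^ 2 / p =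
      ∑ p ∈ P, ∑ a ∈ Finset.Ico 1 N,
        if D ^ 4 < p * a then tau 2 a * ‖nu χ (p * a)‖ ^ 2 / ((p * a : ℕ) : ℝ) else 0 := by
    rw [Finset.sum_comm]
    refine Finset.sum_congr rfl fun a ha => ?_
    rw [Finset.sum_filter, Finset.mul_sum]
    refine Finset.sum_congr rfl fun p hp => ?_
    have ha0 : (a : ℝ) ≠ 0 := by
      have := (Finset.mem_Ico.1 ha).1; exact_mod_cast (by omega : a ≠ 0)
    have hp0 : (p : ℝ) ≠ 0 := by exact_mod_cast (hP p hp).ne_zero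
    split_ifs
    · push_cast; field_simp
    · simp
  rw [hstep1]
  -- for each `p`, inject `a ↦ p a` into `Ioc D⁴ X ∩ {p ∣ ·}`
  have hstep2 : ∀ p ∈ P, ∑ a ∈ Finset.Ico 1 N,
      (if D ^ 4 < p * a then tau 2 a * ‖nu χ (p * a)‖ ^ 2 / ((p * a : ℕ) : ℝ) else 0) ≤
      ∑ n ∈ (Finset.Ioc (D ^ 4) X).filter (fun n => p ∣ n), ‖nu χ n‖ ^ 2 * tau 2 n / n := by
    intro p hp
    have hpr := hP p hp
    rw [← Finset.sum_filter]
    -- the image of the filtered `a`-range under `a ↦ p a`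
    have hinj : Set.InjOn (fun a => p * a) ↑((Finset.Ico 1 N).filter (fun a => D ^ 4 < p * a)) :=
      fun a _ b _ hab => Nat.eq_of_mul_eq_mul_left hpr.pos hab
    calc ∑ a ∈ (Finset.Ico 1 N).filter (fun a => D ^ 4 < p * a),
          tau 2 a * ‖nu χ (p * a)‖ ^ 2 / ((p * a : ℕ) : ℝ)
        ≤ ∑ a ∈ (Finset.Ico 1 N).filter (fun a => D ^ 4 < p * a),
            ‖nu χ (p * a)‖ ^ 2 * tau 2 (p * a) / ((p * a : ℕ) : ℝ) := by
          refine Finset.sum_le_sum fun a ha => ?_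
          have ha' := Finset.mem_filter.1 ha
          have ha0 : a ≠ 0 := by have := (Finset.mem_Ico.1 ha'.1).1; omega
          have hτ : tau 2 a ≤ tau 2 (p * a) :=
            tau_dvd_le (by norm_num) (Dvd.intro_left p rfl) (mul_ne_zero hpr.ne_zero ha0)
          rw [mul_comm (tau 2 a)]
          exact div_le_div_of_nonneg_right (mul_le_mul_of_nonneg_left hτ (by positivity))
            (Nat.cast_nonneg _)
      _ = ∑ n ∈ ((Finset.Ico 1 N).filter (fun a => D ^ 4 < p * a)).image (fun a => p * a),
            ‖nu χ n‖ ^ 2 * tau 2 n / n := by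
          rw [Finset.sum_image hinj]
      _ ≤ ∑ n ∈ (Finset.Ioc (D ^ 4) X).filter (fun n => p ∣ n), ‖nu χ n‖ ^ 2 * tau 2 n / n := by
          refine Finset.sum_le_sum_of_subset_of_nonneg ?_ fun n _ _ =>
            div_nonneg (mul_nonneg (by positivity) (tau_nonneg _ _)) (Nat.cast_nonneg n)
          intro n hn
          rw [Finset.mem_image] at hn
          obtain ⟨a, ha, rfl⟩ := hn
          have ha' := Finset.mem_filter.1 ha
          rw [Finset.mem_filter, Finset.mem_Ioc]
          exact ⟨⟨ha'.2, hX p hp a ha'.1⟩, Dvd.intro a rfl⟩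
  -- sum over p and count multiplicities
  calc ∑ p ∈ P, ∑ a ∈ Finset.Ico 1 N,
        (if D ^ 4 < p * a then tau 2 a * ‖nu χ (p * a)‖ ^ 2 / ((p * a : ℕ) : ℝ) else 0)
      ≤ ∑ p ∈ P, ∑ n ∈ (Finset.Ioc (D ^ 4) X).filter (fun n => p ∣ n), ‖nu χ n‖ ^ 2 * tau 2 n / n :=
        Finset.sum_le_sum hstep2
    _ = ∑ n ∈ Finset.Ioc (D ^ 4) X, ‖nu χ n‖ ^ 2 * tau 2 n / n * ((P.filter (fun p => p ∣ n)).card : ℝ) := by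
        rw [Finset.sum_comm' (t' := Finset.Ioc (D ^ 4) X) (s' := fun n => P.filter (fun p => p ∣ n))]
        · refine Finset.sum_congr rfl fun n _ => ?_
          rw [Finset.sum_const, nsmul_eq_mul, mul_comm]
        · intro p n
          simp only [Finset.mem_filter]
          tauto
    _ ≤ ∑ n ∈ Finset.Ioc (D ^ 4) X, ‖nu χ n‖ ^ 2 * tau 2 n / n * (Nat.log 2 X : ℝ) := by
        refine Finset.sum_le_sum fun n hn => ?_
        have hn' := Finset.mem_Ioc.1 hn
        have hn0 : n ≠ 0 := by omega
        refine mul_le_mul_of_nonneg_left ((card_filter_prime_dvd_le_log P hP hn0).trans ?_)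
          (div_nonneg (mul_nonneg (by positivity) (tau_nonneg _ _)) (Nat.cast_nonneg n))
        exact_mod_cast Nat.log_mono_right hn'.2
    _ = (Nat.log 2 X : ℝ) * ∑ n ∈ Finset.Ioc (D ^ 4) X, ‖nu χ n‖ ^ 2 * tau 2 n / n := by
        rw [Finset.mul_sum]; exact Finset.sum_congr rfl fun n _ => by ring


end Literature.NumberTheory.LFunctions.Zhang2022.Phi3Eval
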